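import Summits.Ventures.PercRepro0.ContinuityCoupling

/-!
# The law of a finitely-determined event is a polynomial (seat p4, block P5 in Lean, 1/2)

For a finite set of bonds `E` and an event `A` determined by `E` (p5's `DeterminedBy`), the probability
`setBer(u, p) A` is the finite sum `∑_{η ⊆ E, η ∈ A} p^{|η|} (1 − p)^{|E| − |η|}` (SHARP-p4-v2 §1, first sentence of
Lemma 1.3).  Steps:

* `setBernoulli_map_inter`: the restriction `ω ↦ ω ∩ E` pushes `setBer(u, p)` to `setBer(u ∩ E, p)` (a coordinatewise
  map of the infinite product, `Measure.infinitePi_map_pi`);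
* `measurableSet_of_determinedBy`: an event determined by a finite set is measurable (a finite union of cylinders);
* `setBernoulli_finset_apply`: on a finite index set the measure of an event is the sum over its configurations
  (Mathlib's `setBernoulli_singleton`);
* `wt E η q = ∏_{e ∈ E} (if e ∈ η then q else 1 − q)` and `locP E 𝒜 q = ∑_{η ⊆ E} 1[𝒜 η] · wt E η q`: the real polynomial,
  and `setBernoulli_toReal_eq_locP`: `(setBer(u, p) A).toReal = locP E (fun η => ↑η ∈ A) p`.

Continued in `Russo.lean` (Russo's formula).
-/

namespace Summit.Ventures.PercRepro0.Russo

open MeasureTheory ProbabilityTheory unitInterval Set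
open Summit.Ventures.PercRepro0.Defs
open scoped ENNReal NNReal Classical

variable {ι : Type*}

/-! ### Restriction to a set of coordinates -/

/-- `ω ↦ ω ∩ E` is measurable. -/
theorem measurable_inter_const (E : Set ι) : Measurable fun ω : Set ι => ω ∩ E := by
  rw [measurable_set_iff]
  intro e
  exact (measurable_set_mem e).and measurable_const

/-- Restricting a configuration to `E` pushes `setBer(u, p)` to `setBer(u ∩ E, p)`. -/
theorem setBernoulli_map_inter (u E : Set ι) (p : I) :
    (setBernoulli u p).map (fun ω : Set ι => ω ∩ E) = setBernoulli (u ∩ E) p := by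
  have hfi : ∀ i : ι, Measurable fun b : Prop => b ∧ i ∈ E := fun _ => measurable_from_top
  have hm : Measurable fun (P : ι → Prop) (i : ι) => P i ∧ i ∈ E :=
    measurable_pi_lambda _ fun i => (measurable_pi_apply i).and measurable_const
  rw [setBernoulli_eq_map, setBernoulli_eq_map, Measure.map_map (measurable_inter_const E) measurable_setOf]
  have hcomp : (fun ω : Set ι => ω ∩ E) ∘ (fun P : ι → Prop => {i | P i}) =
      (fun P : ι → Prop => {i | P i}) ∘ (fun (P : ι → Prop) (i : ι) => P i ∧ i ∈ E) := by
    funext P; ext i; simp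
  rw [hcomp, ← Measure.map_map measurable_setOf hm]
  congr 1
  have key := Measure.infinitePi_map_pi
    (μ := fun i : ι => toNNReal p • Measure.dirac (i ∈ u) + toNNReal (σ p) • Measure.dirac False)
    (f := fun (i : ι) (b : Prop) => b ∧ i ∈ E) hfi
  refine key.trans ?_
  congr 1
  funext i
  rw [Measure.map_add _ _ (hfi i), Measure.map_smul, Measure.map_smul, Measure.map_dirac' (hfi i),
    Measure.map_dirac' (hfi i)]
  have h1 : ((i ∈ u) ∧ i ∈ E) = (i ∈ u ∩ E) := propext (by simp)
  have h2 : (False ∧ i ∈ E) = False := propext (by simp)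
  rw [h1, h2]

/-- A finitely-determined event is measurable. -/
theorem measurableSet_of_determinedBy {E : Set ι} (hE : E.Finite) {A : Set (Set ι)} (hdet : DeterminedBy E A) :
    MeasurableSet A := by
  classical
  have hrepr : A = ⋃ η ∈ hE.toFinset.powerset.filter (fun η : Finset ι => (↑η : Set ι) ∈ A),
      {ω : Set ι | ω ∩ E = ↑η} := by
    ext ω
    simp only [mem_iUnion, mem_setOf_eq, Finset.mem_filter, exists_prop]
    constructor
    · intro hω
      have hfin : (ω ∩ E).Finite := hE.subset inter_subset_right
      refine ⟨hfin.toFinset, ⟨?_, ?_⟩, ?_⟩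
      · rw [Finset.mem_powerset, ← Finset.coe_subset, hfin.coe_toFinset, hE.coe_toFinset]
        exact inter_subset_right
      · rw [hfin.coe_toFinset]; exact (hdet ω (ω ∩ E) fun e he => by simp [he]).1 hω
      · rw [hfin.coe_toFinset]
    · rintro ⟨η, ⟨-, hηA⟩, hωη⟩
      exact (hdet ω (ω ∩ E) fun e he => by simp [he]).2 (hωη ▸ hηA)
  rw [hrepr]
  refine Finset.measurableSet_biUnion _ fun η hη => ?_
  have hηE : ∀ e ∈ η, e ∈ E := fun e he => by
    have := Finset.mem_powerset.1 (Finset.mem_filter.1 hη).1 he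
    simpa using this
  have : {ω : Set ι | ω ∩ E = ↑η} = ⋂ e ∈ E, {ω : Set ι | e ∈ ω ↔ e ∈ η} := by
    ext ω
    simp only [mem_setOf_eq, mem_iInter, Set.ext_iff, mem_inter_iff, Finset.mem_coe]
    constructor
    · intro h e he; have := h e; tauto
    · intro h e
      by_cases he : e ∈ E
      · have := h e he; tauto
      · have : e ∉ η := fun h' => he (hηE e h'); tauto
  rw [this]
  refine MeasurableSet.biInter hE.countable fun e _ => ?_
  by_cases he : e ∈ η
  · simp only [he, iff_true]; exact measurableSet_setOf.2 (measurable_set_mem e)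
  · simp only [he, iff_false]; exact (measurableSet_setOf.2 (measurable_set_mem e)).compl

/-- The law of an event determined by `E ⊆ u` only sees the coordinates of `E`. -/
theorem setBernoulli_eq_of_determinedBy (u : Set ι) (p : I) {E : Set ι} (hE : E ⊆ u) (hEf : E.Finite)
    {A : Set (Set ι)} (hdet : DeterminedBy E A) :
    setBernoulli u p A = setBernoulli E p A := by
  have hA : MeasurableSet A := measurableSet_of_determinedBy hEf hdet
  have hpre : A = (fun ω : Set ι => ω ∩ E) ⁻¹' A := by
    ext ω
    exact hdet ω (ω ∩ E) fun e he => by simp [he]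
  conv_lhs => rw [hpre]
  rw [← Measure.map_apply (measurable_inter_const E) hA, setBernoulli_map_inter, inter_eq_right.2 hE]

/-! ### The finite sum -/

/-- Singletons of `Set ι` are measurable for countable `ι`. -/
theorem measurableSet_singleton_set [Countable ι] (s : Set ι) : MeasurableSet ({s} : Set (Set ι)) := by
  have : ({s} : Set (Set ι)) = ⋂ e : ι, {ω : Set ι | e ∈ ω ↔ e ∈ s} := by
    ext ω
    simp only [mem_singleton_iff, mem_iInter, mem_setOf_eq, Set.ext_iff]
  rw [this]
  refine MeasurableSet.iInter fun e => ?_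
  by_cases he : e ∈ s
  · simp only [he, iff_true]; exact measurableSet_setOf.2 (measurable_set_mem e)
  · simp only [he, iff_false]; exact (measurableSet_setOf.2 (measurable_set_mem e)).compl

/-- On a finite index set, the measure of an event is the sum of the weights of its configurations. -/
theorem setBernoulli_finset_apply [Countable ι] (E : Finset ι) (p : I) (A : Set (Set ι)) :
    setBernoulli (↑E : Set ι) p A =
      ∑ η ∈ E.powerset, if (↑η : Set ι) ∈ A then
        ((toNNReal p ^ η.card * toNNReal (σ p) ^ (E.card - η.card) : ℝ≥0) : ℝ≥0∞) else 0 := by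
  classical
  rw [setBernoulli_apply_eq_apply_subsets]
  have hrepr : {s ∈ A | s ⊆ ↑E} =
      ⋃ η ∈ E.powerset.filter (fun η : Finset ι => (↑η : Set ι) ∈ A), ({(↑η : Set ι)} : Set (Set ι)) := by
    ext s
    simp only [mem_setOf_eq, mem_iUnion, mem_singleton_iff, Finset.mem_filter, Finset.mem_powerset, exists_prop]
    constructor
    · rintro ⟨hsA, hsE⟩
      have hfin : s.Finite := E.finite_toSet.subset hsE
      refine ⟨hfin.toFinset, ⟨?_, ?_⟩, ?_⟩
      · rw [← Finset.coe_subset, hfin.coe_toFinset]; exact hsE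
      · rw [hfin.coe_toFinset]; exact hsA
      · rw [hfin.coe_toFinset]
    · rintro ⟨η, ⟨hηE, hηA⟩, rfl⟩
      exact ⟨hηA, Finset.coe_subset.2 hηE⟩
  rw [hrepr, measure_biUnion_finset]
  · rw [Finset.sum_filter]
    refine Finset.sum_congr rfl fun η hη => ?_
    split_ifs with h
    · rw [setBernoulli_singleton p (Finset.coe_subset.2 (Finset.mem_powerset.1 hη)) E.finite_toSet,
        ← Finset.coe_sdiff, Set.ncard_coe_finset, Set.ncard_coe_finset,
        Finset.card_sdiff_of_subset (Finset.mem_powerset.1 hη)]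
      push_cast
      rfl
    · rfl
  · intro η _ η' _ hne
    simp only [Function.onFun]
    rw [Set.disjoint_singleton]
    exact fun h => hne (Finset.coe_injective h)
  · exact fun η _ => measurableSet_singleton_set _

/-! ### The real polynomial -/

/-- The weight of the configuration `η` at parameter `q`, as a product over the coordinates of `E`. -/
noncomputable def wt [DecidableEq ι] (E η : Finset ι) (q : ℝ) : ℝ :=
  ∏ e ∈ E, if e ∈ η then q else 1 - q

/-- `wt E η q = q^{|η|} (1 − q)^{|E| − |η|}` for `η ⊆ E`. -/
theorem wt_eq_pow [DecidableEq ι] {E η : Finset ι} (hη : η ⊆ E) (q : ℝ) :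
    wt E η q = q ^ η.card * (1 - q) ^ (E.card - η.card) := by
  unfold wt
  rw [Finset.prod_ite, Finset.prod_const, Finset.prod_const]
  have h1 : E.filter (fun e => e ∈ η) = η := by
    ext e; simp only [Finset.mem_filter]; exact ⟨fun h => h.2, fun h => ⟨hη h, h⟩⟩
  have h2 : (E.filter (fun e => ¬ e ∈ η)).card = E.card - η.card := by
    have := Finset.card_filter_add_card_filter_not (s := E) (p := fun e => e ∈ η)
    rw [h1] at this
    omega
  rw [h1, h2]

/-- Weights are nonnegative for `q ∈ [0,1]`. -/
theorem wt_nonneg [DecidableEq ι] (E η : Finset ι) {q : ℝ} (h0 : 0 ≤ q) (h1 : q ≤ 1) : 0 ≤ wt E η q :=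
  Finset.prod_nonneg fun e _ => by split_ifs <;> linarith

/-- The polynomial `∑_{η ⊆ E} 1[𝒜 η] · wt E η q`. -/
noncomputable def locP [DecidableEq ι] (E : Finset ι) (𝒜 : Finset ι → Prop) [DecidablePred 𝒜] (q : ℝ) : ℝ :=
  ∑ η ∈ E.powerset, if 𝒜 η then wt E η q else 0

/-- `locP` only depends on the predicate on the subsets of `E`. -/
theorem locP_congr [DecidableEq ι] (E : Finset ι) {𝒜 ℬ : Finset ι → Prop} [DecidablePred 𝒜] [DecidablePred ℬ]
    (h : ∀ η ∈ E.powerset, (𝒜 η ↔ ℬ η)) (q : ℝ) : locP E 𝒜 q = locP E ℬ q := by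
  unfold locP
  refine Finset.sum_congr rfl fun η hη => ?_
  simp only [h η hη]

/-- The law of a finitely-determined event is the polynomial `locP`. -/
theorem setBernoulli_toReal_eq_locP [Countable ι] (u : Set ι) (p : I) (E : Finset ι)
    (hE : (↑E : Set ι) ⊆ u) {A : Set (Set ι)} (hdet : DeterminedBy (↑E) A) :
    (setBernoulli u p A).toReal = locP E (fun η : Finset ι => (↑η : Set ι) ∈ A) p := by
  rw [setBernoulli_eq_of_determinedBy u p hE E.finite_toSet hdet, setBernoulli_finset_apply,
    ENNReal.toReal_sum (fun η _ => by
      split_ifs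
      · push_cast
        exact ENNReal.mul_ne_top (ENNReal.pow_ne_top ENNReal.coe_ne_top) (ENNReal.pow_ne_top ENNReal.coe_ne_top)
      · simp)]
  unfold locP
  refine Finset.sum_congr rfl fun η hη => ?_
  split_ifs with h
  · rw [wt_eq_pow (Finset.mem_powerset.1 hη)]
    push_cast
    rw [ENNReal.toReal_mul, ENNReal.toReal_pow, ENNReal.toReal_pow, ENNReal.coe_toReal, ENNReal.coe_toReal]
    have e1 : ((toNNReal p : ℝ≥0) : ℝ) = p := rfl
    have e2 : ((toNNReal (σ p) : ℝ≥0) : ℝ) = 1 - p := unitInterval.coe_symm_eq p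
    rw [e1, e2]
  · simp

end Summit.Ventures.PercRepro0.Russo
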